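import Literature.Barriers.CriticalPhenomena.LongRangeTrivialityOnZ3BlockSpinAudit
import Literature.Barriers.CriticalPhenomena.LongRangeTrivialityOnZ3Field
import HarnessLib

/-!
# Audit (D-0021), generation 14, of `LongRangeTrivialityOnZ3Proofs.lean`: the FIELD direction —
# Griffiths' cap of the critical block moment generating function by the critical isotherm, and the
# isotherm of the Gaussian members of `Z3Model`

Barrier catalogue `Literature/Barriers/CriticalPhenomena/` (D-0021), sub-problem `Ising3DConformalLimit`.
Fourteenth audit record (refuter, barrier-audit mode, 2026-08-16) for `LongRangeTrivialityOnZ3Proofs.lean`, the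
file discharging the named fact `panis_variance_bound` (Panis 2023, §1.2.1, footnote to the definition of
`T_{f,L,β}`) by `panis_variance_bound_holds`. Records of generations 1, 5, 6, 9, 11 are in
`LongRangeTrivialityOnZ3ProofsAudit.lean`, generation 10 in `LongRangeTrivialityOnZ3BlockSpinAudit.lean`; the
parent block (`LongRangeTrivialityOnZ3.lean`) carries generations 2–4, 7, 8, 12. Every one of them CONFIRMED the
discharge and isolated NECESSARY nearest-neighbour inputs that are all either zero-field TWO-POINT statements
(bubble divergence, `limsup χ_L(β_c)/L^{3/2} > 0`, the strict window `η < 1/2`) or STRUCTURAL (locality / Markov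
property, light tail of the coupling, anisotropy-sensitivity) — and the parent block, its nine audit files and the
two proofs files never mention the magnetic field: `grep isotherm|Lee–Yang|in a field|one-arm` over them returns
two occurrences of "one-arm", both about `d > 4`. This generation audits the barrier FROM THE FIELD DIRECTION
(`h > 0` at `β_c`): the critical isotherm `h ↦ m(β_c,h)` read at the block-fluctuation field scale
`h_L(z) = z/(β_c√Σ_L(β_c))`, where the audited file's objects live (`Σ_L`, the block `M_L = ∑_{x∈Λ_L}σ_x`,
`T_L = M_L/√Σ_L` — Panis's own normalising example `f = 𝟙_{[-1,1]^d}`, `⟨T_L²⟩ = 1`). A separate leaf file is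
used, as in every generation, so that the 36 modules importing `…Proofs` are not rebuilt. Everything below is
PROVED; ONE named statement is added (`IsothermDominanceOnZ3`, with its proof `IsothermDominanceOnZ3_holds`,
D-0026), plus the abbreviation `LongRangeIsing.cubeIndicator` for the spelling of `𝟙_{[-1,1]^d}` used by
`LongRangeTrivialityOnZ3BlockSpin`.

## Verdict: CONFIRMED (the discharge; the formal barrier; the technique class) and NARROWED (`evasions_known` /
## caveat (e) of the parent block: the field direction is a route the barrier does not touch, whose decisive
## input — an ISOTHERM DEFICIT at the fluctuation scale — is SUFFICIENT for block non-Gaussianity by an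
## interaction-uniform theorem and fails, quantitatively, for every `α < 3/2` member)

### A. The discharge (re-checked) and what this generation does not redo

`panis_variance_bound_holds` and `LongRangeTrivialityOnZ3_holds` close on `propext`, `Classical.choice`,
`Quot.sound`; nothing in the audited file is a definition or a named fact (generations 1, 5, 9). The footnote's
first clause `⟨T²_{𝟙,L,β}⟩ = 1`, the upper half with an `f`-only constant and without continuity, the literal
falsity of the lower half and its truth for `f ≥ 0`, the `r^d`-erratum, the sharply cut block: generations 1,
9, 10, 11. Not repeated.

### B. The gap in the block's list of qualifying inputs: the critical isotherm

* THE CAP (interaction-uniform, PROVED here for every translation-invariant ferromagnetic pair interaction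
  `J ≥ 0` on `ℤ^d`, `β ≥ 0`; §§1–3). Tilting the zero-field free state by `e^{βhM_L}` is the pair system of
  Friedli–Velenik §3.8.1 with the extra SITE couplings `βh·𝟙_{Λ_L}` (`LongRangeIsing.expectIn_mul_blockTilt_div_eq_gksExpect`);
  Griffiths' comparison of couplings `βh𝟙_{Λ_L} ≤ βh` [cite: FriedliVelenik2017, Exercise 3.31, p. 142], the
  monotone volume limit and translation invariance give the BLOCK-FIELD DOMINATION
  `⟨M_L e^{βhM_L}⟩_{Λ,J,0,β} ≤ |Λ_L|·m(β,h)·⟨e^{βhM_L}⟩_{Λ,J,0,β}`, `m(β,h) = ⟨σ₀⟩_{J,h,β}`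
  (`LongRangeIsing.expectIn_blockSpin_mul_blockTilt_le`), and Jensen's inequality in the tilted state turns it into
  the two-field comparison `⟨e^{βh₂M_L}⟩_{J,0,β} ≤ exp(β(h₂-h₁)|Λ_L|m(β,h₂))·⟨e^{βh₁M_L}⟩_{J,0,β}`, `0 ≤ h₁ ≤ h₂`
  (`LongRangeIsing.state_blockTilt_le_exp_mul`; one-field form `log⟨e^{zT_L}⟩ ≤ z|Λ_L|m(β,h_L(z))/√Σ_L`,
  `LongRangeIsing.state_blockTilt_le_exp`). This is the `d`-dimensional, free-state, derivative-free form of the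
  first step of Camia–Garban–Newman's derivation of the planar magnetisation exponent: "the main idea in the
  proof of the upper bound is to rewrite … `⟨M_L⟩_{β_c,h,+} = ⟨M_Le^{hM_L}⟩_{β_c,0,+}/⟨e^{hM_L}⟩_{β_c,0,+}
  = ∂_h⟨e^{hM_L}⟩/⟨e^{hM_L}⟩` and then to apply the GHS inequality … `F(h) ≤ F(0) + hF′(0)`"
  [cite: CamiaGarbanNewman2012, §2 (the display defining F(h) and eq. (2.2)), p. 4] — here Griffiths II replaces
  GHS (the field is compared, not Taylor-expanded), exactly as in the card `flat-isotherm-subquadratic-mgf` and in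
  the landed `stub_blockFieldDomination` of line `SketchPub` (plus states, nearest-neighbour formalisation).
* SUFFICIENCY (interaction-uniform, PROVED: `LongRangeIsing.not_tendsto_mgfDeviation_of_isothermDeficit`,
  `blockNonGaussian_of_isothermDeficit`). If for some `z, c > 0` and infinitely many `L`,
  `|Λ_L|·m(β,h_L(z)) ≤ (1-c)·z√Σ_L/2` — an ISOTHERM DEFICIT against (half) the block's linear response at the
  fluctuation scale — then `⟨e^{zT_L}⟩_{J,0,β} ≤ e^{(1-c)z²/2}` there, so `⟨e^{zT_L}⟩ ↛ e^{z²/2}`: the block spin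
  is not Gaussian in the sense whose interaction-uniform status generation 10 settled
  (`not_interactionUniformZ3_blockSpin_mgf`). In exponent language (on paper): with `m(β_c,h) ≤ Ah^{1/δ}` and
  `Σ_L ≥ aL^{d+2-η}`, `log⟨e^{zT_L}⟩ ≤ |Λ_L|β_c∫₀^{h_L(z)}m ≤ C z^{1+1/δ}L^{d-(δ+1)(d+2-η)/(2δ)}`, uniform in
  `L` iff `δ ≤ δ_hyp := (d+2-η)/(d-2+η)` — the magnetic HYPERSCALING relation, of which `δ ≥ δ_hyp` is a theorem
  (Buckingham–Gunton, Fisher) [cite: Fisher1969]; then `Cz^{1+1/δ} < z²/2` for large `z`. In `d = 2` this is a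
  printed proof of non-Gaussianity: "`log P(m > x) ∼ -cx^{16}` … this provides an alternative proof that the field
  `Φ^∞` is non-Gaussian … `|E e^{itm}| ≤ e^{-c̃|t|^{16/15}}`" [cite: CamiaGarbanNewman2016, Theorem 1.2 (i)–(ii), p. 2].
* NECESSITY OF ITS FAILURE FOR THE GAUSSIAN MEMBERS (PROVED: `LongRangeIsing.isotherm_dominates_of_blockGaussian`,
  `IsothermDominanceOnZ3_holds`, `not_isothermDeficit_algebraic`, `not_interactionUniformZ3_isothermDeficit`).
  For every `C₀|x-y|₁^{-3-α}`, `0 < α < 3/2`, and all `z, ε > 0`: eventually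
  `(1-ε)z√Σ_L ≤ |Λ_L|m(β_c,h_L(z))` — the isotherm DOMINATES block linear response; the two Gaussian limits
  `e^{(1-ε)²z²/2}`, `e^{z²/2}` of generation 10 (`LongRangeTrivialityOnZ3BlockSpin_holds`)
  [cite: Panis2023Triviality, Theorem 1.2] are incompatible with a response deficit through the two-field
  comparison (`gaussianGap_false`: `(1-ε)² + 2ε(1-ε) = 1 - ε² < 1`). So "isotherm deficit" is not
  interaction-uniform — consistent with, and an instance of, the parent barrier — and it is the first qualifying
  input on the barrier side that is also sufficient.
* QUANTITATIVELY (on paper, page-level inputs): the members over-respond. "the exponents `β̂, δ, γ` and `Δ₄`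
  exist and take their mean-field values … `δ = 3` … as soon as `d_bnd := d/min{1,σ/2} ≥ 4`, i.e. if `σ ≤ d/2`"
  [cite: AizenmanFernandez1988, Abstract and eqs. (1.2)–(1.3), pp. 39–40], with the isotherm bounds
  "`ch^{1/3} ≤ M(β_c,h) ≤ C′h^{1/3}|ln h|^μ`", `μ = 0` unless `d_eff = 4`
  [cite: AizenmanFernandez1988, Proposition 2.1 (b), eq. (2.10), p. 43]; with `Σ_L(β_c) ≍ L^{3+α}` (infrared bound
  up, the susceptibility lower bound down; generation 11 §F3) the response ratio is
  `|Λ_L|m(β_c,h_L(z))/(z√Σ_L) ≍ z^{-2/3}L^{3-(3+α)/6-(3+α)/2} = z^{-2/3}L^{(3-2α)/3} → ∞`: `δ = 3 > δ_hyp = (3+α)/(3-α)`,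
  and the over-response exponent is Panis's `3 - 2α`. The mean-field lower bound `M(β_c,h) ≥ ch^{1/3}` holds for
  the whole Griffiths–Simon class [cite: AizenmanBarskyFernandezJSP1987], so a deficit on `ℤ³` (where
  `h_L ≍ L^{-(5-η)/2}`, `z√Σ_L/|Λ_L| ≍ L^{-(1+η)/2}`) needs `(5-η)/6 ≥ (1+η)/2`, i.e. `η ≤ 1/2` — generation 8's
  window again, from the field side.
* STATUS FOR `J_nn` ON `ℤ³`: OPEN, and already the planners' target — the residual S6 "upper critical isotherm
  `m(β_c,h) ≤ Ah^{1/5}`" (at `η = 0`) of crux `CoulombImpliesNontrivial` (route `PerfectScreening`, item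
  stmt-CriticalPhenomena-13885, line `SketchPub`: `stub_cruxOfUpperCriticalIsotherm`; `stub_isothermOfOneArm`
  reduces it to the one-arm bound `⟨σ₀⟩⁺_{box L;β_c,0} ≤ CL^{-1/2}`; `stub_lowerCriticalIsotherm` proves the
  Fisher-sharp converse), and crux K1 (one-arm hyperscaling `⟨σ₀⟩⁺_{Λ_R} ≤ C⟨σ₀σ_{Re₁}⟩^{1/2}`) of the card
  `flat-isotherm-subquadratic-mgf` (graded variant of Camia–Garban–Newman). That card places itself against
  `LongRangeTrivialityOnZ3` through the nearest-neighbour MARKOV SANDWICH used to derive the isotherm bound; the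
  audit's sharper statement is that the CONCLUSION-BEARING input (deficit ⟺ `δ`-hyperscaling with amplitudes)
  fails by itself for every `α < 3/2` member, whatever tool derives it — and must, by the theorem of this file.
  Above `d_c` it fails for `J_nn` as well (one-arm exponent `1`, `⟨σ₀⟩⁺_{Λ_R} ≫ G(R)^{1/2} ≍ R^{-(d-2)/2}`)
  [cite: HandaHeydenreichSakai2016] [cite: EngelenburgEtAl2025], matching `IsingTrivialityFromDimensionFour`.

### C. What the parent block should say (text; proposed separately as a patch, recorded here in case it is not applied)

`evasions_known`, append: "AUDIT 2026-08-16, generation 14 (`LongRangeTrivialityOnZ3IsothermAudit.lean`): the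
FIELD direction is untouched by generations 1–13 — the in-field one-point input 'isotherm deficit at the
fluctuation scale', `|Λ_L|m(β_c,z/(β_c√Σ_L)) ≤ (1-c)z√Σ_L/2` i.o. (exponent form: the upper critical isotherm
`m(β_c,h) = O(h^{1/δ_hyp})`, `δ_hyp = (5-η)/(1+η)`, with `Σ_L ≥ cL^{5-η}`; implied by one-arm hyperscaling), is
SUFFICIENT for block non-Gaussianity for every ferromagnet (Griffiths' cap + Jensen, PROVED) and fails for every
`α < 3/2` member, which dominate block linear response (`IsothermDominanceOnZ3_holds`; `δ = 3 > δ_hyp`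
[AizenmanFernandez1988 (2.10)]); open for `J_nn` on `ℤ³` (route `PerfectScreening` residual S6 / card
`flat-isotherm-subquadratic-mgf` K1), proved in `d = 2` [CamiaGarbanNewman2016 Thm 1.2]". `scope_caveats (e)`:
replace "nothing is said about … other inputs distinguishing `α ≥ 3/2`" by a pointer to generations 2–14.

### D. Search log (generation 14) and degraded services

Tree: the parent block, `…ProofsAudit`, `…BubbleAudit`, `…PointwiseAudit`, `…SusceptibilityAudit`,
`…LocalityAudit`, `…PerturbativeAudit`, `…MarginalAudit`, `…BlockSpinAudit`, `…LayeredAudit` grepped for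
`isotherm|Lee–Yang|field direction|one-arm|m(β_c,h)` (2 hits, both high-`d` one-arm papers); Summits side:
`Theorems/PerfectScreeningCoulombImpliesNontrivial{BlockFieldDomination,LowerIsotherm,IsothermOfOneArm,OfUpperCriticalIsotherm}.lean`
read (nearest-neighbour `plusExpect` formalisation; not bridged to `LongRangeIsing.state`, as for `NNIsing` in
generation 1). Literature to 2026-08-16: arXiv listing sweeps ("random currents Ising", "Ising scaling limit
Gaussian", "Panis Ising", "Duminil-Copin Ising", "one-arm exponent Ising", 2025–2026): new since generation 11 —
Panis–Schapira, *On reversing the Simon–Lieb inequality in high-dimensional percolation* (arXiv:2605.30299),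
Panagiotis–Veitch, *Subcritical sharpness for real-valued spin models* (arXiv:2605.31344), Bhowal et al.,
*Scaling limits for Ising models on inhomogeneous random graphs* (arXiv:2608.12804) — none on `d = 3`
non-triviality or on the critical isotherm of `ℤ³`; forward citations of Panis 2023: the same 8 works as in
generations 6–11. The local hybrid index answered once with a connection reset (search-degraded: local full text;
the arXiv/Crossref legs answered). Read at page level this generation: Camia–Garban–Newman 2012 (p. 4) and 2016
(p. 2); Aizenman–Fernández 1988 (pp. 39–40, 43).

Verdict: CONFIRMED + NARROWED (`evasions_known`); one named statement (`IsothermDominanceOnZ3`, proved); card seed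
recorded in the session notes (the gap is the planners' existing line — no new card is claimed, the seed points
route `PerfectScreening` / card `flat-isotherm-subquadratic-mgf` to the quantitative form of their residual:
beat `Φ_L(z) := |Λ_L|m(β_c,h_L(z))/√Σ_L ≤ (1-c)z/2` at ONE `z`, no exponent needed).

## Contents

* §1 `LongRangeIsing.expectIn_pos'`, `gksHamiltonian_pairBlockField`, `gksWeight_pairBlockField`,
  `expectIn_mul_blockTilt_div_eq_gksExpect`, `expectIn_spinAt_mul_blockTilt_div_le`,
  `expectIn_spinAt_mul_blockTilt_le`, `expectIn_blockSpin_mul_blockTilt_le` (finite volume, Griffiths II);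
* §2 `exp_mul_one_add_sub_le_exp`, `expectIn_blockTilt_le_exp_mul` (Jensen, finite volume);
* §3 `blockTilt_eq_comp_restrictTo`, `tendsto_expectIn_box_window`, `tendsto_expectIn_box_blockTilt`,
  `state_blockTilt_zero`, `state_blockTilt_le_exp_mul`, `state_blockTilt_le_exp` (infinite volume);
* §4 `cubeIndicator`, `exp_mul_smeared_cubeIndicator_eq`, `state_exp_mul_smeared_cubeIndicator_eq`,
  `mgfDeviation_cubeIndicator_eq`, `tendsto_state_blockTilt_of_gaussian`,
  `not_tendsto_mgfDeviation_of_isothermDeficit` (sufficiency), `state_blockTilt_le_of_responseDeficit`,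
  `gaussianGap_false`, `gaussianGap_pos`, `isotherm_dominates_of_blockGaussian` (necessity);
* §5 `IsothermDominanceOnZ3` (+ `_holds`), `blockNonGaussian_of_isothermDeficit`, `not_isothermDeficit_algebraic`,
  `not_interactionUniformZ3_isothermDeficit`.

## References

* F. Camia, C. Garban, C. M. Newman, *The Ising magnetization exponent on `ℤ²` is `1/15`*, Probab. Theory
  Related Fields 160 (2014), arXiv:1205.6612, §2 (proof of the upper bound), p. 4 of the arXiv version
  [CamiaGarbanNewman2012] (held; read pp. 2–5).
* F. Camia, C. Garban, C. M. Newman, *Planar Ising magnetization field II*, Ann. Inst. H. Poincaré Probab.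
  Stat. 52 (2016), arXiv:1307.3926, Theorem 1.2 (i)–(iii), p. 2 [CamiaGarbanNewman2016] (held; read pp. 2–6).
* M. Aizenman, R. Fernández, *Critical exponents for long-range interactions*, Lett. Math. Phys. 16 (1988)
  39–49: Abstract, (1.2)–(1.3), Proposition 2.1 (b) eq. (2.10) [AizenmanFernandez1988] (held; read pp. 39–40, 43).
* M. Aizenman, D. J. Barsky, R. Fernández, J. Stat. Phys. 47 (1987) 343–374 (`M(β_c,h) ≥ ch^{1/3}`)
  [AizenmanBarskyFernandezJSP1987] (cited for the mean-field bound; not re-read).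
* M. E. Fisher, *Rigorous inequalities for critical-point correlation exponents*, Phys. Rev. 180 (1969) 594–600
  [Fisher1969] (the Buckingham–Gunton inequality `δ ≥ (d+2-η)/(d-2+η)`; cited, not re-read).
* C. M. Newman, Comm. Math. Phys. 41 (1975) 1–9, Theorem 5 [Newman1975] (through `…LeeYang`, `…GaussianMGF`).
* S. Handa, M. Heydenreich, A. Sakai, arXiv:1612.08809 [HandaHeydenreichSakai2016]; D. van Engelenburg,
  C. Garban, R. Panis, F. Severo, *One-arm exponents of the high-dimensional Ising model*, arXiv:2510.23423
  [EngelenburgEtAl2025] (abstracts; the `d > 4` one-arm exponent `1`).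
* R. Panis, arXiv:2309.05797 (2023) = Ann. Probab. 54 (2026), §1.2.1 (footnote, p. 6), Theorem 1.2
  [Panis2023Triviality]; S. Friedli, Y. Velenik, CUP (2017), §3.8.1, Exercise 3.31 [FriedliVelenik2017].

## Tree anchors

`LongRangeIsing.expectIn`, `pairGibbsWeight`, `pairHamiltonian`, `state`, `blockVariance`, `smeared`,
`mgfDeviation`, `algebraicCoupling`, `InteractionUniformZ3`, `not_interactionUniformZ3_of_counterexample`
(`LongRangeTrivialityOnZ3`); `gksHamiltonian_pair`, `expectIn_add/const_mul/finset_sum/const/nonneg/mono`,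
`partitionSum_pos`, `pairGibbsWeight_pos`, `one_le_blockVariance`, `state_const` (`…Proofs`);
`expectIn_spinProduct_eq_gksExpect_field`, `expectIn_le_state_field`, `state_spinAt_eq_state_spinAt_zero`,
`state_spinProduct_nonneg_field`, `spinProduct_singleton_eq_spinAt` (`…Field`); `expectIn_spinAt_eq_gksExpect`,
`inVol_singleton_coe` (`…HighTemperature`); `restrictTo`, `state_comp_restrictTo`,
`tendsto_expectIn_box_comp_restrictTo` (`…Moments`); `smeared_cubeIndicator_eq`,
`state_smeared_cubeIndicator_sq_eq_one`, `LongRangeTrivialityOnZ3BlockSpin_holds` (`…BlockSpinAudit`);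
`panis_criticalBeta_pos_holds`, `algebraicCoupling_nonneg`, `algebraicCoupling_add` (`…CriticalBeta`, `…Proofs`);
`gksExpect_mono_of_abs_le`, `spinAt_glue_of_mem`, `spinAt_glue_coe` (`GKSInequalities`); Mathlib:
`Real.add_one_le_exp`, `div_div_div_cancel_right₀`, `le_of_tendsto_of_tendsto`, `Filter.Frequently.and_eventually`,
`Filter.Tendsto.eventually_lt_const`, `Filter.Tendsto.eventually_const_lt`, `tendsto_iff_norm_sub_tendsto_zero`.
-/

noncomputable section

namespace Literature.Barriers.CriticalPhenomena

open Literature.Probability.LatticeModels Literature.Probability.Percolation Filter Topology Finset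
open scoped symmDiff

namespace LongRangeIsing

variable {d : ℕ}

/-! ### 1. Finite volume: the block-tilted free state is the pair system with a field on the block -/

section BlockField

variable (J : Site d → Site d → ℝ) (Λ : Finset (Site d)) (β h : ℝ) (L : ℕ)

/-- Positivity of `⟨F⟩_{Λ,J,h,β}` for `F > 0`. [folklore] -/
theorem expectIn_pos' {F : SpinConfig (Site d) → ℝ} (hF : ∀ σ, 0 < F σ) :
    0 < expectIn J Λ β h F :=
  div_pos (Finset.sum_pos (fun τ _ => mul_pos (hF _) (pairGibbsWeight_pos J Λ β h τ)) Finset.univ_nonempty)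
    (partitionSum_pos J Λ β h)

/-- The energy of the pair system `ν_{Λ;K}` with couplings `K_{(z,w)} = (β/2)J_{z,w}` on the ordered pairs of
`Λ` and the BLOCK field `K_z = βh·𝟙{z ∈ Λ_L}` on the sites (`Λ_L ⊆ Λ`):
`∑ᵢ Kᵢ τ_{Cᵢ} = -βH_{Λ,J,0}(τ·free) + βh ∑_{x∈Λ_L} σ_x`. [folklore] -/
theorem gksHamiltonian_pairBlockField (hΛ : box d L ⊆ Λ) (τ : SpinConfig ↥Λ) :
    gksHamiltonian (univ : Finset ((↥Λ × ↥Λ) ⊕ ↥Λ))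
        (Sum.elim (fun p : ↥Λ × ↥Λ => β / 2 * J p.1 p.2)
          fun z : ↥Λ => if (z : Site d) ∈ box d L then β * h else 0)
        (Sum.elim (fun p : ↥Λ × ↥Λ => {p.1} ∆ {p.2}) fun z => {z}) τ =
      -β * pairHamiltonian J Λ 0 (glue Λ τ .free) +
        β * h * ∑ x ∈ box d L, spinAt x (glue Λ τ .free) := by
  have hpair := gksHamiltonian_pair J Λ β τ
  rw [gksHamiltonian] at hpair ⊢
  rw [Fintype.sum_sum_type]
  simp only [Sum.elim_inl, Sum.elim_inr]
  rw [hpair]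
  congr 1
  have hS : ∑ z : ↥Λ, (if (z : Site d) ∈ box d L then β * h else 0) * spinProduct {z} τ =
      ∑ x ∈ Λ, if x ∈ box d L then β * h * spinAt x (glue Λ τ .free) else 0 := by
    rw [← Finset.sum_coe_sort Λ]
    refine Finset.sum_congr rfl fun z _ => ?_
    rw [spinProduct_singleton_eq_spinAt, spinAt_glue_coe]
    split_ifs
    · rfl
    · rw [zero_mul]
  rw [hS, ← Finset.sum_filter, Finset.filter_mem_eq_inter, Finset.inter_eq_right.2 hΛ, Finset.mul_sum]

/-- The weight of that system is the zero-field Gibbs weight tilted by `e^{βh M_L}`, `M_L = ∑_{x∈Λ_L}σ_x`.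
[folklore] -/
theorem gksWeight_pairBlockField (hΛ : box d L ⊆ Λ) (τ : SpinConfig ↥Λ) :
    gksWeight (univ : Finset ((↥Λ × ↥Λ) ⊕ ↥Λ))
        (Sum.elim (fun p : ↥Λ × ↥Λ => β / 2 * J p.1 p.2)
          fun z : ↥Λ => if (z : Site d) ∈ box d L then β * h else 0)
        (Sum.elim (fun p : ↥Λ × ↥Λ => {p.1} ∆ {p.2}) fun z => {z}) τ =
      pairGibbsWeight J Λ β 0 τ * Real.exp (β * h * ∑ x ∈ box d L, spinAt x (glue Λ τ .free)) := by
  rw [gksWeight, gksHamiltonian_pairBlockField J Λ β h L hΛ, Real.exp_add, pairGibbsWeight]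

/-- **The block-tilted free state is the pair system with a field on the block**:
`⟨F e^{βhM_L}⟩_{Λ,J,0,β} / ⟨e^{βhM_L}⟩_{Λ,J,0,β} = ⟨F(·free)⟩_{Λ;K}` with `K` as in
`gksHamiltonian_pairBlockField`. [folklore] -/
theorem expectIn_mul_blockTilt_div_eq_gksExpect (hΛ : box d L ⊆ Λ) (F : SpinConfig (Site d) → ℝ) :
    expectIn J Λ β 0 (fun σ => F σ * Real.exp (β * h * ∑ x ∈ box d L, spinAt x σ)) /
        expectIn J Λ β 0 (fun σ => Real.exp (β * h * ∑ x ∈ box d L, spinAt x σ)) =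
      gksExpect (univ : Finset ((↥Λ × ↥Λ) ⊕ ↥Λ))
        (Sum.elim (fun p : ↥Λ × ↥Λ => β / 2 * J p.1 p.2)
          fun z : ↥Λ => if (z : Site d) ∈ box d L then β * h else 0)
        (Sum.elim (fun p : ↥Λ × ↥Λ => {p.1} ∆ {p.2}) fun z => {z}) (fun τ => F (glue Λ τ .free)) := by
  have hZ := partitionSum_pos J Λ β 0
  rw [expectIn, expectIn, div_div_div_cancel_right₀ hZ.ne', gksExpect, gksSum, gksSum]
  simp_rw [gksWeight_pairBlockField J Λ β h L hΛ, one_mul]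
  congr 1
  · exact Finset.sum_congr rfl fun τ _ => by ring
  · exact Finset.sum_congr rfl fun τ _ => by ring

/-- **Griffiths II for the block field**: switching the field `h ≥ 0` on inside the block only magnetises a
site at most as much as the homogeneous field does,
`⟨σ_x e^{βhM_L}⟩_{Λ,J,0,β} / ⟨e^{βhM_L}⟩_{Λ,J,0,β} ≤ ⟨σ_x⟩_{Λ,J,h,β}` (`β, h ≥ 0`, `J ≥ 0`; comparison of the
site couplings `βh𝟙_{Λ_L} ≤ βh`, Friedli–Velenik 2017, Exercise 3.31). [cite: FriedliVelenik2017, Exercise 3.31, p. 142] -/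
theorem expectIn_spinAt_mul_blockTilt_div_le (hβ : 0 ≤ β) (hh : 0 ≤ h) (hJ : ∀ x y, 0 ≤ J x y)
    (hΛ : box d L ⊆ Λ) {x : Site d} (hx : x ∈ Λ) :
    expectIn J Λ β 0 (fun σ => spinAt x σ * Real.exp (β * h * ∑ y ∈ box d L, spinAt y σ)) /
        expectIn J Λ β 0 (fun σ => Real.exp (β * h * ∑ y ∈ box d L, spinAt y σ)) ≤
      expectIn J Λ β h (spinAt x) := by
  classical
  rw [expectIn_mul_blockTilt_div_eq_gksExpect J Λ β h L hΛ (spinAt x)]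
  have hobs : (fun τ : SpinConfig ↥Λ => spinAt x (glue Λ τ .free)) = spinProduct ({⟨x, hx⟩} : Finset ↥Λ) := by
    funext τ
    rw [spinProduct_singleton_eq_spinAt]
    exact spinAt_glue_of_mem τ .free hx
  have hrhs : expectIn J Λ β h (spinAt x) =
      gksExpect (univ : Finset ((↥Λ × ↥Λ) ⊕ ↥Λ))
        (Sum.elim (fun p : ↥Λ × ↥Λ => β / 2 * J p.1 p.2) fun _ : ↥Λ => β * h)
        (Sum.elim (fun p : ↥Λ × ↥Λ => {p.1} ∆ {p.2}) fun z => {z})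
        (spinProduct ({⟨x, hx⟩} : Finset ↥Λ)) := by
    exact expectIn_spinAt_eq_gksExpect J Λ β h ⟨x, hx⟩
  rw [hobs, hrhs]
  refine gksExpect_mono_of_abs_le _ _ (fun i _ => ?_) _
  rcases i with p | z
  · simp only [Sum.elim_inl]
    rw [abs_of_nonneg (mul_nonneg (by positivity) (hJ _ _))]
  · simp only [Sum.elim_inr]
    split_ifs
    · rw [abs_of_nonneg (mul_nonneg hβ hh)]
    · rw [abs_zero]; exact mul_nonneg hβ hh

/-- **Block-field domination, one site** (Griffiths II, monotone volume limit and translation invariance):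
`⟨σ_x e^{βhM_L}⟩_{Λ,J,0,β} ≤ ⟨σ₀⟩_{J,h,β} · ⟨e^{βhM_L}⟩_{Λ,J,0,β}` for `x ∈ Λ ⊇ Λ_L`, where
`⟨σ₀⟩_{J,h,β} = m(β,h)` is the infinite-volume magnetisation in the homogeneous field `h ≥ 0`
(the Griffiths step of Camia–Garban–Newman's upper bound for the magnetisation exponent, there with `+`
boundary conditions). [cite: CamiaGarbanNewman2016, §2 (proof of the upper bound via GHS/Griffiths), p. 4] -/
theorem expectIn_spinAt_mul_blockTilt_le (hβ : 0 ≤ β) (hh : 0 ≤ h) (hJ : ∀ x y, 0 ≤ J x y)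
    (hJt : ∀ a x y, J (x + a) (y + a) = J x y) (hΛ : box d L ⊆ Λ) {x : Site d} (hx : x ∈ Λ) :
    expectIn J Λ β 0 (fun σ => spinAt x σ * Real.exp (β * h * ∑ y ∈ box d L, spinAt y σ)) ≤
      state J β h (spinAt 0) * expectIn J Λ β 0 (fun σ => Real.exp (β * h * ∑ y ∈ box d L, spinAt y σ)) := by
  have hWpos : 0 < expectIn J Λ β 0 (fun σ => Real.exp (β * h * ∑ y ∈ box d L, spinAt y σ)) :=
    expectIn_pos' J Λ β 0 fun σ => Real.exp_pos _
  have h1 := expectIn_spinAt_mul_blockTilt_div_le J Λ β h L hβ hh hJ hΛ hx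
  have h2 : expectIn J Λ β h (spinAt x) ≤ state J β h (spinAt 0) := by
    rw [← state_spinAt_eq_state_spinAt_zero J β h hβ hh hJ hJt x, ← spinProduct_singleton_eq_spinAt]
    exact expectIn_le_state_field J β h hβ hh hJ (Finset.singleton_subset_iff.2 hx)
  rw [div_le_iff₀ hWpos] at h1
  exact h1.trans (mul_le_mul_of_nonneg_right h2 hWpos.le)

/-- **Block-field domination** (summed over the block): `⟨M_L e^{βhM_L}⟩_{Λ,J,0,β} ≤ |Λ_L|·m(β,h)·⟨e^{βhM_L}⟩_{Λ,J,0,β}`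
— the magnetisation of the block in a field acting on the block only is at most `|Λ_L|` times the
infinite-volume magnetisation in the homogeneous field. [cite: CamiaGarbanNewman2016, §2 (proof of the upper bound via GHS/Griffiths), p. 4] -/
theorem expectIn_blockSpin_mul_blockTilt_le (hβ : 0 ≤ β) (hh : 0 ≤ h) (hJ : ∀ x y, 0 ≤ J x y)
    (hJt : ∀ a x y, J (x + a) (y + a) = J x y) (hΛ : box d L ⊆ Λ) :
    expectIn J Λ β 0 (fun σ => (∑ x ∈ box d L, spinAt x σ) * Real.exp (β * h * ∑ y ∈ box d L, spinAt y σ)) ≤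
      (#(box d L) : ℝ) * state J β h (spinAt 0) *
        expectIn J Λ β 0 (fun σ => Real.exp (β * h * ∑ y ∈ box d L, spinAt y σ)) := by
  have hlin : expectIn J Λ β 0 (fun σ => (∑ x ∈ box d L, spinAt x σ) * Real.exp (β * h * ∑ y ∈ box d L, spinAt y σ)) =
      ∑ x ∈ box d L, expectIn J Λ β 0 (fun σ => spinAt x σ * Real.exp (β * h * ∑ y ∈ box d L, spinAt y σ)) := by
    rw [← expectIn_finset_sum]
    congr 1
    funext σ
    rw [Finset.sum_mul]
  rw [hlin]
  calc ∑ x ∈ box d L, expectIn J Λ β 0 (fun σ => spinAt x σ * Real.exp (β * h * ∑ y ∈ box d L, spinAt y σ))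
      ≤ ∑ x ∈ box d L, state J β h (spinAt 0) *
          expectIn J Λ β 0 (fun σ => Real.exp (β * h * ∑ y ∈ box d L, spinAt y σ)) :=
        Finset.sum_le_sum fun x hx => expectIn_spinAt_mul_blockTilt_le J Λ β h L hβ hh hJ hJt hΛ (hΛ hx)
    _ = (#(box d L) : ℝ) * state J β h (spinAt 0) *
        expectIn J Λ β 0 (fun σ => Real.exp (β * h * ∑ y ∈ box d L, spinAt y σ)) := by
        rw [Finset.sum_const, nsmul_eq_mul, mul_assoc]

end BlockField

/-! ### 2. Jensen: comparing the block moment generating function at two fields -/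

section Jensen

variable (J : Site d → Site d → ℝ) (β : ℝ) (L : ℕ)

/-- `e^y ≥ e^a (1 + (y - a))` (convexity of the exponential). [folklore] -/
theorem exp_mul_one_add_sub_le_exp (a y : ℝ) : Real.exp a * (1 + (y - a)) ≤ Real.exp y := by
  have h1 : (y - a) + 1 ≤ Real.exp (y - a) := Real.add_one_le_exp _
  calc Real.exp a * (1 + (y - a)) = Real.exp a * ((y - a) + 1) := by ring
    _ ≤ Real.exp a * Real.exp (y - a) := mul_le_mul_of_nonneg_left h1 (Real.exp_pos a).le
    _ = Real.exp y := by rw [← Real.exp_add]; congr 1; ring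

/-- **Two-field comparison of the block moment generating function, finite volume**: for
`0 ≤ h₁ ≤ h₂`, `β ≥ 0`, a translation-invariant `J ≥ 0` and `Λ ⊇ Λ_L`,
`⟨e^{βh₂M_L}⟩_{Λ,J,0,β} ≤ exp(β(h₂-h₁)|Λ_L| m(β,h₂)) ⟨e^{βh₁M_L}⟩_{Λ,J,0,β}` — Jensen's inequality in
the state tilted by `e^{βh₂M_L}` (`⟨e^{-βΔM_L}⟩ ≥ e^{-βΔ⟨M_L⟩}`) and the block-field domination
`⟨M_L⟩_{tilt} ≤ |Λ_L| m(β,h₂)`; in differential form this is `(d/dh) log⟨e^{βhM_L}⟩ ≤ β|Λ_L| m(β,h)`,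
the Griffiths cap of Camia–Garban–Newman. [cite: CamiaGarbanNewman2016, §2 (proof of the upper bound via GHS/Griffiths), p. 4] -/
theorem expectIn_blockTilt_le_exp_mul (hβ : 0 ≤ β) (hJ : ∀ x y, 0 ≤ J x y)
    (hJt : ∀ a x y, J (x + a) (y + a) = J x y) {h₁ h₂ : ℝ} (hh₁ : 0 ≤ h₁) (h12 : h₁ ≤ h₂)
    {Λ : Finset (Site d)} (hΛ : box d L ⊆ Λ) :
    expectIn J Λ β 0 (fun σ => Real.exp (β * h₂ * ∑ y ∈ box d L, spinAt y σ)) ≤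
      Real.exp (β * (h₂ - h₁) * #(box d L) * state J β h₂ (spinAt 0)) *
        expectIn J Λ β 0 (fun σ => Real.exp (β * h₁ * ∑ y ∈ box d L, spinAt y σ)) := by
  set M : SpinConfig (Site d) → ℝ := fun σ => ∑ y ∈ box d L, spinAt y σ with hM
  set W₁ : SpinConfig (Site d) → ℝ := fun σ => Real.exp (β * h₁ * M σ) with hW₁
  set W₂ : SpinConfig (Site d) → ℝ := fun σ => Real.exp (β * h₂ * M σ) with hW₂
  set m : ℝ := state J β h₂ (spinAt 0) with hm
  set N : ℝ := (#(box d L) : ℝ) with hN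
  set a : ℝ := -(β * (h₂ - h₁) * N * m) with ha
  have hh₂ : 0 ≤ h₂ := hh₁.trans h12
  have hΔ : 0 ≤ β * (h₂ - h₁) := mul_nonneg hβ (sub_nonneg.2 h12)
  -- pointwise: `W₁ = e^{-βΔM} W₂ ≥ e^a (1 + (-βΔM - a)) W₂`
  have hpt : ∀ σ, Real.exp a * ((1 - a) * W₂ σ + -(β * (h₂ - h₁)) * (M σ * W₂ σ)) ≤ W₁ σ := by
    intro σ
    have h1 := exp_mul_one_add_sub_le_exp a (-(β * (h₂ - h₁)) * M σ)
    have h2 : Real.exp (-(β * (h₂ - h₁)) * M σ) * W₂ σ = W₁ σ := by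
      rw [hW₁, hW₂]
      dsimp only
      rw [← Real.exp_add]
      congr 1
      ring
    have hW₂pos : 0 < W₂ σ := Real.exp_pos _
    calc Real.exp a * ((1 - a) * W₂ σ + -(β * (h₂ - h₁)) * (M σ * W₂ σ))
        = Real.exp a * (1 + (-(β * (h₂ - h₁)) * M σ - a)) * W₂ σ := by ring
      _ ≤ Real.exp (-(β * (h₂ - h₁)) * M σ) * W₂ σ := mul_le_mul_of_nonneg_right h1 hW₂pos.le
      _ = W₁ σ := h2
  -- take expectations
  have hE := expectIn_mono J Λ β 0 hpt
  rw [expectIn_const_mul, expectIn_add, expectIn_const_mul, expectIn_const_mul] at hE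
  have hdom : expectIn J Λ β 0 (fun σ => M σ * W₂ σ) ≤ N * m * expectIn J Λ β 0 W₂ :=
    expectIn_blockSpin_mul_blockTilt_le J Λ β h₂ L hβ hh₂ hJ hJt hΛ
  have hW₂E : 0 ≤ expectIn J Λ β 0 W₂ := expectIn_nonneg J Λ β 0 fun σ => (Real.exp_pos _).le
  -- `e^a · E[W₂] ≤ E[W₁]`
  have key : Real.exp a * expectIn J Λ β 0 W₂ ≤ expectIn J Λ β 0 W₁ := by
    have h3 : Real.exp a * expectIn J Λ β 0 W₂ ≤
        Real.exp a * ((1 - a) * expectIn J Λ β 0 W₂ + -(β * (h₂ - h₁)) * expectIn J Λ β 0 (fun σ => M σ * W₂ σ)) := by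
      refine mul_le_mul_of_nonneg_left ?_ (Real.exp_pos a).le
      have h4 : -(β * (h₂ - h₁)) * expectIn J Λ β 0 (fun σ => M σ * W₂ σ) ≥ -(β * (h₂ - h₁)) * (N * m * expectIn J Λ β 0 W₂) :=
        mul_le_mul_of_nonpos_left hdom (neg_nonpos.2 hΔ)
      have h5 : (1 - a) * expectIn J Λ β 0 W₂ + -(β * (h₂ - h₁)) * (N * m * expectIn J Λ β 0 W₂) = expectIn J Λ β 0 W₂ := by
        rw [ha]; ring
      linarith
    exact h3.trans hE
  have hexp : Real.exp (β * (h₂ - h₁) * N * m) * Real.exp a = 1 := by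
    rw [ha, ← Real.exp_add, add_neg_cancel, Real.exp_zero]
  calc expectIn J Λ β 0 W₂ = Real.exp (β * (h₂ - h₁) * N * m) * (Real.exp a * expectIn J Λ β 0 W₂) := by
        rw [← mul_assoc, hexp, one_mul]
    _ ≤ Real.exp (β * (h₂ - h₁) * N * m) * expectIn J Λ β 0 W₁ :=
        mul_le_mul_of_nonneg_left key (Real.exp_pos _).le

end Jensen

/-! ### 3. Infinite volume: the two-field comparison for the free box-limit state -/

section InfiniteVolume

variable (J : Site d → Site d → ℝ) (β : ℝ) (L : ℕ)

/-- The block tilt `e^{βhM_L}` is a window observable on `Λ_L`. [folklore] -/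
theorem blockTilt_eq_comp_restrictTo (h : ℝ) :
    (fun σ : SpinConfig (Site d) => Real.exp (β * h * ∑ y ∈ box d L, spinAt y σ)) =
      fun σ => (fun τ : SpinConfig ↥(box d L) => Real.exp (β * h * ∑ z : ↥(box d L), spinAt z τ))
        (restrictTo (box d L) σ) := by
  funext σ
  simp only
  rw [← Finset.sum_coe_sort (box d L)]
  rfl

/-- Finite-volume expectations of a window observable converge to its infinite-volume expectation
(`β ≥ 0`, `J ≥ 0`; `tendsto_expectIn_box_comp_restrictTo` and `state_comp_restrictTo` of `…Moments`). [folklore] -/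
theorem tendsto_expectIn_box_window (hβ : 0 ≤ β) (hJ : ∀ x y, 0 ≤ J x y) (B : Finset (Site d))
    (G : SpinConfig ↥B → ℝ) :
    Tendsto (fun M : ℕ => expectIn J (box d M) β 0 (fun σ => G (restrictTo B σ))) atTop
      (𝓝 (state J β 0 (fun σ => G (restrictTo B σ)))) := by
  have h := tendsto_expectIn_box_comp_restrictTo J β B hβ hJ G
  rwa [← state_comp_restrictTo J β B hβ hJ G] at h

/-- `⟨e^{βhM_L}⟩_{Λ_M,J,0,β} → ⟨e^{βhM_L}⟩_{J,0,β}` (`β ≥ 0`, `J ≥ 0`; a window observable). [folklore] -/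
theorem tendsto_expectIn_box_blockTilt (hβ : 0 ≤ β) (hJ : ∀ x y, 0 ≤ J x y) (h : ℝ) :
    Tendsto (fun M : ℕ => expectIn J (box d M) β 0 (fun σ => Real.exp (β * h * ∑ y ∈ box d L, spinAt y σ)))
      atTop (𝓝 (state J β 0 (fun σ => Real.exp (β * h * ∑ y ∈ box d L, spinAt y σ)))) := by
  have hw := tendsto_expectIn_box_window J β hβ hJ (box d L)
    (fun τ : SpinConfig ↥(box d L) => Real.exp (β * h * ∑ z : ↥(box d L), spinAt z τ))
  rw [blockTilt_eq_comp_restrictTo]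
  exact hw

/-- `⟨e^{β·0·M_L}⟩_{J,0,β} = 1`. [folklore] -/
theorem state_blockTilt_zero : state J β 0 (fun σ => Real.exp (β * 0 * ∑ y ∈ box d L, spinAt y σ)) = 1 := by
  have h1 : (fun σ : SpinConfig (Site d) => Real.exp (β * 0 * ∑ y ∈ box d L, spinAt y σ)) = fun _ => 1 := by
    funext σ; simp
  rw [h1, state_const]

/-- **Two-field comparison of the block moment generating function in the infinite-volume free state**
("Griffiths' cap of the block mgf by the isotherm", integrated between two fields): for `0 ≤ h₁ ≤ h₂`,
`β ≥ 0` and a translation-invariant ferromagnetic pair interaction `J ≥ 0` on `ℤ^d`,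
`⟨e^{βh₂M_L}⟩_{J,0,β} ≤ exp(β(h₂ - h₁)|Λ_L| m(β,h₂)) · ⟨e^{βh₁M_L}⟩_{J,0,β}`, `m(β,h) = ⟨σ₀⟩_{J,h,β}`.
With `h₁ = 0`: `log⟨e^{βhM_L}⟩_{J,0,β} ≤ βh|Λ_L| m(β,h)` — the block's moment generating function is capped by
(an upper Riemann sum of) the area under the isotherm `h' ↦ |Λ_L| m(β,h')`, the `d`-dimensional, free-state form
of the first step of Camia–Garban–Newman's derivation of the planar magnetisation exponent.
[cite: CamiaGarbanNewman2016, §2 (proof of the upper bound via GHS/Griffiths), p. 4] -/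
theorem state_blockTilt_le_exp_mul (hβ : 0 ≤ β) (hJ : ∀ x y, 0 ≤ J x y)
    (hJt : ∀ a x y, J (x + a) (y + a) = J x y) {h₁ h₂ : ℝ} (hh₁ : 0 ≤ h₁) (h12 : h₁ ≤ h₂) :
    state J β 0 (fun σ => Real.exp (β * h₂ * ∑ y ∈ box d L, spinAt y σ)) ≤
      Real.exp (β * (h₂ - h₁) * #(box d L) * state J β h₂ (spinAt 0)) *
        state J β 0 (fun σ => Real.exp (β * h₁ * ∑ y ∈ box d L, spinAt y σ)) := by
  refine le_of_tendsto_of_tendsto (tendsto_expectIn_box_blockTilt J β L hβ hJ h₂)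
    ((tendsto_expectIn_box_blockTilt J β L hβ hJ h₁).const_mul _) ?_
  filter_upwards [eventually_ge_atTop L] with M hM
  exact expectIn_blockTilt_le_exp_mul J β L hβ hJ hJt hh₁ h12 (box_mono d hM)

/-- One-field form: `⟨e^{βhM_L}⟩_{J,0,β} ≤ exp(βh|Λ_L| m(β,h))` for `h ≥ 0`.
[cite: CamiaGarbanNewman2016, §2 (proof of the upper bound via GHS/Griffiths), p. 4] -/
theorem state_blockTilt_le_exp (hβ : 0 ≤ β) (hJ : ∀ x y, 0 ≤ J x y)
    (hJt : ∀ a x y, J (x + a) (y + a) = J x y) {h : ℝ} (hh : 0 ≤ h) :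
    state J β 0 (fun σ => Real.exp (β * h * ∑ y ∈ box d L, spinAt y σ)) ≤
      Real.exp (β * h * #(box d L) * state J β h (spinAt 0)) := by
  have h1 := state_blockTilt_le_exp_mul J β L hβ hJ hJt le_rfl hh
  rwa [state_blockTilt_zero, mul_one, sub_zero] at h1

end InfiniteVolume

/-! ### 4. The critical block spin `T_L = M_L/√Σ_L` (`f = 𝟙_{[-1,1]^d}`): moment generating function in the
block field `h_L(z) = z/(β√Σ_L)` -/

section BlockSpin

/-- Panis's normalising test function `𝟙_{[-1,1]^d}` (the sharply cut block; the spelling of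
`LongRangeTrivialityOnZ3BlockSpin`). [cite: Panis2023Triviality, §1.2.1 (footnote: f = 𝟙_{[-1,1]^d}), p. 6] -/
abbrev cubeIndicator (d : ℕ) : EuclideanSpace ℝ (Fin d) → ℝ :=
  Set.indicator {u : EuclideanSpace ℝ (Fin d) | ∀ i, |u i| ≤ 1} fun _ => (1 : ℝ)

variable (J : Site d → Site d → ℝ) (β : ℝ)

/-- `e^{zT_L} = e^{βh_L(z)M_L}` with the block field `h_L(z) = z/(β√Σ_L)` (`β > 0`, `L ≥ 1`). [folklore] -/
theorem exp_mul_smeared_cubeIndicator_eq (hβ : 0 < β) (hJ : ∀ x y, 0 ≤ J x y) {L : ℕ} (hL : 1 ≤ L)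
    (z : ℝ) (σ : SpinConfig (Site d)) :
    Real.exp (z * smeared J β L (cubeIndicator d) σ) =
      Real.exp (β * (z / (β * Real.sqrt (blockVariance J β L))) * ∑ y ∈ box d L, spinAt y σ) := by
  rw [smeared_cubeIndicator_eq J β hL σ]
  congr 1
  have hV : 0 < Real.sqrt (blockVariance J β L) :=
    Real.sqrt_pos.2 (by linarith [one_le_blockVariance J β hβ.le hJ L])
  field_simp

/-- `⟨e^{zT_L}⟩_{J,0,β} = ⟨e^{βh_L(z)M_L}⟩_{J,0,β}`. [folklore] -/
theorem state_exp_mul_smeared_cubeIndicator_eq (hβ : 0 < β) (hJ : ∀ x y, 0 ≤ J x y) {L : ℕ} (hL : 1 ≤ L)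
    (z : ℝ) :
    state J β 0 (fun σ => Real.exp (z * smeared J β L (cubeIndicator d) σ)) =
      state J β 0 (fun σ => Real.exp (β * (z / (β * Real.sqrt (blockVariance J β L))) * ∑ y ∈ box d L, spinAt y σ)) := by
  have h1 : (fun σ => Real.exp (z * smeared J β L (cubeIndicator d) σ)) =
      fun σ => Real.exp (β * (z / (β * Real.sqrt (blockVariance J β L))) * ∑ y ∈ box d L, spinAt y σ) :=
    funext fun σ => exp_mul_smeared_cubeIndicator_eq J β hβ hJ hL z σ
  rw [h1]

/-- The moment-generating-function deviation of the block spin is `|⟨e^{βh_L(z)M_L}⟩_{J,0,β} - e^{z²/2}|`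
(`⟨T_L²⟩ = 1`, `state_smeared_cubeIndicator_sq_eq_one`). [cite: Panis2023Triviality, §1.2.1 (footnote: ⟨T²⟩ = 1 for f = 𝟙_{[-1,1]^d}), p. 6] -/
theorem mgfDeviation_cubeIndicator_eq (hβ : 0 < β) (hJ : ∀ x y, 0 ≤ J x y) {L : ℕ} (hL : 1 ≤ L) (z : ℝ) :
    mgfDeviation J β L (cubeIndicator d) z =
      |state J β 0 (fun σ => Real.exp (β * (z / (β * Real.sqrt (blockVariance J β L))) * ∑ y ∈ box d L, spinAt y σ)) -
        Real.exp (z ^ 2 / 2)| := by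
  rw [mgfDeviation, state_smeared_cubeIndicator_sq_eq_one J β hβ.le hJ hL, mul_one,
    state_exp_mul_smeared_cubeIndicator_eq J β hβ hJ hL z]

/-- Gaussian block asymptotics in the form `⟨e^{βh_L(z)M_L}⟩_{J,0,β} → e^{z²/2}`. [folklore] -/
theorem tendsto_state_blockTilt_of_gaussian (hβ : 0 < β) (hJ : ∀ x y, 0 ≤ J x y) {z : ℝ}
    (hG : Tendsto (fun L : ℕ => mgfDeviation J β L (cubeIndicator d) z) atTop (𝓝 0)) :
    Tendsto (fun L : ℕ => state J β 0 (fun σ => Real.exp (β * (z / (β * Real.sqrt (blockVariance J β L))) *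
      ∑ y ∈ box d L, spinAt y σ))) atTop (𝓝 (Real.exp (z ^ 2 / 2))) := by
  rw [tendsto_iff_norm_sub_tendsto_zero]
  refine hG.congr' ?_
  filter_upwards [eventually_ge_atTop 1] with L hL
  rw [Real.norm_eq_abs, mgfDeviation_cubeIndicator_eq J β hβ hJ hL z]

/-- **Sufficiency (interaction-uniform): an ISOTHERM DEFICIT at the block field forces a non-Gaussian critical
block spin.** For a translation-invariant ferromagnetic pair interaction `J ≥ 0` on `ℤ^d` and `β > 0`: if for
some `z > 0`, `c > 0` and infinitely many `L` the infinite-volume magnetisation in the homogeneous field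
`h_L(z) = z/(β√Σ_L)` is at most `(1 - c)` times HALF the block's linear response,
`|Λ_L| · m(β, h_L(z)) ≤ (1 - c) · z√Σ_L / 2`, then `⟨e^{zT_L}⟩_{J,0,β} ≤ e^{(1-c)z²/2}` at those `L`, so the
moment generating function of `T_L = M_L/√Σ_L` does not tend to the Gaussian one. (The `d = 3`,
free-state, sharply-cut form of "the critical isotherm is too flat for a Gaussian" — Camia–Garban–Newman's
route to the planar tail `log P(m > x) ∼ -cx^{16}`, "an alternative proof that the field `Φ^∞` is
non-Gaussian".) [cite: CamiaGarbanNewman2016, Theorem 1.2 (i)–(ii) and §2, pp. 2 and 4] -/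
theorem not_tendsto_mgfDeviation_of_isothermDeficit (hβ : 0 < β) (hJ : ∀ x y, 0 ≤ J x y)
    (hJt : ∀ a x y, J (x + a) (y + a) = J x y) {z c : ℝ} (hz : 0 < z) (hc : 0 < c)
    (hdef : ∃ᶠ L : ℕ in atTop, (#(box d L) : ℝ) *
        state J β (z / (β * Real.sqrt (blockVariance J β L))) (spinAt 0) ≤
      (1 - c) * z * Real.sqrt (blockVariance J β L) / 2) :
    ¬ Tendsto (fun L : ℕ => mgfDeviation J β L (cubeIndicator d) z) atTop (𝓝 0) := by
  intro hT
  set δ₀ : ℝ := Real.exp (z ^ 2 / 2) - Real.exp ((1 - c) * z ^ 2 / 2) with hδ₀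
  have hcz : 0 < c * z ^ 2 := by positivity
  have hδ₀pos : 0 < δ₀ := sub_pos.2 (Real.exp_lt_exp.2 (by nlinarith))
  have hev : ∀ᶠ L : ℕ in atTop, mgfDeviation J β L (cubeIndicator d) z < δ₀ := hT.eventually_lt_const hδ₀pos
  obtain ⟨L, ⟨hLdef, hL1⟩, hLlt⟩ :=
    ((hdef.and_eventually (eventually_ge_atTop 1)).and_eventually hev).exists
  set V := blockVariance J β L with hV
  have hV1 : 1 ≤ V := one_le_blockVariance J β hβ.le hJ L
  have hsV : 0 < Real.sqrt V := Real.sqrt_pos.2 (by linarith)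
  set h : ℝ := z / (β * Real.sqrt V) with hh
  have hh0 : 0 ≤ h := by positivity
  -- the cap at this `L`
  have hcap := state_blockTilt_le_exp J β L hβ.le hJ hJt hh0
  have hexp : β * h * #(box d L) * state J β h (spinAt 0) ≤ (1 - c) * z ^ 2 / 2 := by
    have h1 : β * h * #(box d L) * state J β h (spinAt 0) =
        (z / Real.sqrt V) * ((#(box d L) : ℝ) * state J β h (spinAt 0)) := by
      rw [hh]; field_simp
    rw [h1]
    calc z / Real.sqrt V * ((#(box d L) : ℝ) * state J β h (spinAt 0))
        ≤ z / Real.sqrt V * ((1 - c) * z * Real.sqrt V / 2) :=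
          mul_le_mul_of_nonneg_left hLdef (div_nonneg hz.le hsV.le)
      _ = (1 - c) * z ^ 2 / 2 := by field_simp
  have hstate : state J β 0 (fun σ => Real.exp (β * h * ∑ y ∈ box d L, spinAt y σ)) ≤
      Real.exp ((1 - c) * z ^ 2 / 2) := hcap.trans (Real.exp_le_exp.2 hexp)
  rw [mgfDeviation_cubeIndicator_eq J β hβ hJ hL1 z] at hLlt
  have habs : δ₀ ≤ |state J β 0 (fun σ => Real.exp (β * h * ∑ y ∈ box d L, spinAt y σ)) - Real.exp (z ^ 2 / 2)| := by
    rw [abs_sub_comm, abs_of_nonneg (by linarith)]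
    linarith
  exact absurd (habs.trans_lt hLlt) (lt_irrefl _)

/-- Two-field comparison at the fluctuation scale: if at some `L ≥ 1` the magnetisation in the block field
falls short of `(1-ε)` times linear response, `|Λ_L| m(β, z/(β√Σ_L)) < (1-ε) z√Σ_L`, then
`⟨e^{zT_L}⟩ ≤ e^{ε(1-ε)z²} ⟨e^{(1-ε)zT_L}⟩`. [cite: CamiaGarbanNewman2016, §2 (proof of the upper bound via GHS/Griffiths), p. 4] -/
theorem state_blockTilt_le_of_responseDeficit (hβ : 0 < β) (hJ : ∀ x y, 0 ≤ J x y)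
    (hJt : ∀ a x y, J (x + a) (y + a) = J x y) {z ε : ℝ} (hz : 0 < z) (hε : 0 < ε) (hε1 : ε ≤ 1) (L : ℕ)
    (hlt : (#(box d L) : ℝ) * state J β (z / (β * Real.sqrt (blockVariance J β L))) (spinAt 0) <
      (1 - ε) * z * Real.sqrt (blockVariance J β L)) :
    state J β 0 (fun σ => Real.exp (β * (z / (β * Real.sqrt (blockVariance J β L))) * ∑ y ∈ box d L, spinAt y σ)) ≤
      Real.exp (ε * (1 - ε) * z ^ 2) *
        state J β 0 (fun σ => Real.exp (β * ((1 - ε) * z / (β * Real.sqrt (blockVariance J β L))) *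
          ∑ y ∈ box d L, spinAt y σ)) := by
  have hV1 : 1 ≤ blockVariance J β L := one_le_blockVariance J β hβ.le hJ L
  have hsV : 0 < Real.sqrt (blockVariance J β L) := Real.sqrt_pos.2 (by linarith)
  have hβV : 0 < β * Real.sqrt (blockVariance J β L) := mul_pos hβ hsV
  have h1ε : 0 ≤ 1 - ε := by linarith
  have h12 : (1 - ε) * z / (β * Real.sqrt (blockVariance J β L)) ≤ z / (β * Real.sqrt (blockVariance J β L)) :=
    div_le_div_of_nonneg_right (by nlinarith) hβV.le
  have hh₁ : 0 ≤ (1 - ε) * z / (β * Real.sqrt (blockVariance J β L)) :=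
    div_nonneg (mul_nonneg h1ε hz.le) hβV.le
  have hcmp := state_blockTilt_le_exp_mul J β L hβ.le hJ hJt hh₁ h12
  have hW₁ : 0 ≤ state J β 0 (fun σ => Real.exp (β * ((1 - ε) * z / (β * Real.sqrt (blockVariance J β L))) *
      ∑ y ∈ box d L, spinAt y σ)) :=
    ge_of_tendsto' (tendsto_expectIn_box_blockTilt J β L hβ.le hJ _) fun M =>
      expectIn_nonneg J _ β 0 fun σ => (Real.exp_pos _).le
  refine hcmp.trans (mul_le_mul_of_nonneg_right (Real.exp_le_exp.2 ?_) hW₁)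
  have hid : β * (z / (β * Real.sqrt (blockVariance J β L)) - (1 - ε) * z / (β * Real.sqrt (blockVariance J β L))) *
      #(box d L) * state J β (z / (β * Real.sqrt (blockVariance J β L))) (spinAt 0) =
      (ε * z / Real.sqrt (blockVariance J β L)) *
        ((#(box d L) : ℝ) * state J β (z / (β * Real.sqrt (blockVariance J β L))) (spinAt 0)) := by
    field_simp
    ring
  rw [hid]
  have hc : 0 ≤ ε * z / Real.sqrt (blockVariance J β L) := div_nonneg (mul_nonneg hε.le hz.le) hsV.le
  calc ε * z / Real.sqrt (blockVariance J β L) *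
        ((#(box d L) : ℝ) * state J β (z / (β * Real.sqrt (blockVariance J β L))) (spinAt 0))
      ≤ ε * z / Real.sqrt (blockVariance J β L) * ((1 - ε) * z * Real.sqrt (blockVariance J β L)) :=
        mul_le_mul_of_nonneg_left hlt.le hc
    _ = ε * (1 - ε) * z ^ 2 := by
        field_simp

/-- The real-variable inequality behind `isotherm_dominates_of_blockGaussian`: the two Gaussian limits
`e^{z²/2}`, `e^{(1-ε)²z²/2}` are incompatible with the factor `e^{ε(1-ε)z²}` (`(1-ε)² + 2ε(1-ε) = 1 - ε² < 1`).
[folklore] -/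
theorem gaussianGap_false {z ε A₁ A₂ δ : ℝ} (hz : 0 < z) (hε : 0 < ε)
    (hδ : δ = (Real.exp (z ^ 2 / 2) - Real.exp (ε * (1 - ε) * z ^ 2) * Real.exp (((1 - ε) * z) ^ 2 / 2)) /
      (2 * (1 + Real.exp (ε * (1 - ε) * z ^ 2))))
    (h₂ : Real.exp (z ^ 2 / 2) - δ < A₂) (h₁ : A₁ < Real.exp (((1 - ε) * z) ^ 2 / 2) + δ)
    (hb : A₂ ≤ Real.exp (ε * (1 - ε) * z ^ 2) * A₁) : False := by
  set E : ℝ := Real.exp (ε * (1 - ε) * z ^ 2) with hE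
  have hEpos : 0 < E := Real.exp_pos _
  set g : ℝ := Real.exp (z ^ 2 / 2) - E * Real.exp (((1 - ε) * z) ^ 2 / 2) with hg
  have hgpos : 0 < g := by
    rw [hg, hE, ← Real.exp_add, sub_pos, Real.exp_lt_exp]
    have h1 : 0 < ε ^ 2 * z ^ 2 := by positivity
    nlinarith
  have h3 : Real.exp (z ^ 2 / 2) - δ < E * (Real.exp (((1 - ε) * z) ^ 2 / 2) + δ) :=
    calc Real.exp (z ^ 2 / 2) - δ < A₂ := h₂
      _ ≤ E * A₁ := hb
      _ < E * (Real.exp (((1 - ε) * z) ^ 2 / 2) + δ) := mul_lt_mul_of_pos_left h₁ hEpos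
  have h4 : g < δ * (1 + E) := by linarith [h3, hg]
  have h5 : δ * (1 + E) = g / 2 := by
    rw [hδ, hg]
    field_simp
  linarith

/-- The gap parameter of `gaussianGap_false` is positive. [folklore] -/
theorem gaussianGap_pos {z ε : ℝ} (hz : 0 < z) (hε : 0 < ε) :
    0 < (Real.exp (z ^ 2 / 2) - Real.exp (ε * (1 - ε) * z ^ 2) * Real.exp (((1 - ε) * z) ^ 2 / 2)) /
      (2 * (1 + Real.exp (ε * (1 - ε) * z ^ 2))) := by
  have hg : 0 < Real.exp (z ^ 2 / 2) - Real.exp (ε * (1 - ε) * z ^ 2) * Real.exp (((1 - ε) * z) ^ 2 / 2) := by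
    rw [← Real.exp_add, sub_pos, Real.exp_lt_exp]
    have h1 : 0 < ε ^ 2 * z ^ 2 := by positivity
    nlinarith
  positivity

/-- **Necessity (the isotherm of a Gaussian block): NO isotherm deficit.** If the critical block spin of a
translation-invariant ferromagnet `J ≥ 0` at `β > 0` has Gaussian moment-generating-function asymptotics
(`|⟨e^{zT_L}⟩ - e^{z²/2}| → 0` for every `z`), then for every `z > 0` and `ε > 0`, eventually in `L`,
`(1 - ε) · z√Σ_L ≤ |Λ_L| · m(β, z/(β√Σ_L))`: the infinite-volume magnetisation in the block field of `z`
fluctuation units is at least the FULL linear block response `z√Σ_L/|Λ_L|` per site — the isotherm dominates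
block linear response at the fluctuation scale. Proof: the two-field comparison between `(1-ε)z` and `z`
(`state_blockTilt_le_of_responseDeficit`) against the Gaussian limits `e^{(1-ε)²z²/2}`, `e^{z²/2}`
(`gaussianGap_false`). [cite: CamiaGarbanNewman2016, §2 (proof of the upper bound via GHS/Griffiths), p. 4] -/
theorem isotherm_dominates_of_blockGaussian (hβ : 0 < β) (hJ : ∀ x y, 0 ≤ J x y)
    (hJt : ∀ a x y, J (x + a) (y + a) = J x y)
    (hG : ∀ z : ℝ, Tendsto (fun L : ℕ => mgfDeviation J β L (cubeIndicator d) z) atTop (𝓝 0))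
    {z ε : ℝ} (hz : 0 < z) (hε : 0 < ε) :
    ∀ᶠ L : ℕ in atTop, (1 - ε) * z * Real.sqrt (blockVariance J β L) ≤
      (#(box d L) : ℝ) * state J β (z / (β * Real.sqrt (blockVariance J β L))) (spinAt 0) := by
  rcases le_or_gt 1 ε with hε1 | hε1
  · refine Eventually.of_forall fun L => ?_
    have h1 : (1 - ε) * z * Real.sqrt (blockVariance J β L) ≤ 0 :=
      mul_nonpos_of_nonpos_of_nonneg (mul_nonpos_of_nonpos_of_nonneg (by linarith) hz.le) (Real.sqrt_nonneg _)
    have h2 : 0 ≤ (#(box d L) : ℝ) * state J β (z / (β * Real.sqrt (blockVariance J β L))) (spinAt 0) := by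
      refine mul_nonneg (Nat.cast_nonneg _) ?_
      rw [← spinProduct_singleton_eq_spinAt]
      exact state_spinProduct_nonneg_field J β _ hβ.le
        (div_nonneg hz.le (mul_nonneg hβ.le (Real.sqrt_nonneg _))) hJ {0}
    exact h1.trans h2
  by_contra hnot
  rw [Filter.not_eventually] at hnot
  set δ : ℝ := (Real.exp (z ^ 2 / 2) - Real.exp (ε * (1 - ε) * z ^ 2) * Real.exp (((1 - ε) * z) ^ 2 / 2)) /
      (2 * (1 + Real.exp (ε * (1 - ε) * z ^ 2))) with hδ
  have hδpos : 0 < δ := gaussianGap_pos hz hε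
  have hev₂ : ∀ᶠ L : ℕ in atTop, Real.exp (z ^ 2 / 2) - δ <
      state J β 0 (fun σ => Real.exp (β * (z / (β * Real.sqrt (blockVariance J β L))) * ∑ y ∈ box d L, spinAt y σ)) :=
    (tendsto_state_blockTilt_of_gaussian J β hβ hJ (hG z)).eventually_const_lt (by linarith)
  have hev₁ : ∀ᶠ L : ℕ in atTop,
      state J β 0 (fun σ => Real.exp (β * (((1 - ε) * z) / (β * Real.sqrt (blockVariance J β L))) *
        ∑ y ∈ box d L, spinAt y σ)) < Real.exp (((1 - ε) * z) ^ 2 / 2) + δ :=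
    (tendsto_state_blockTilt_of_gaussian J β hβ hJ (hG ((1 - ε) * z))).eventually_lt_const (by linarith)
  obtain ⟨L, hLnot, hL2, hL1⟩ := (hnot.and_eventually (hev₂.and hev₁)).exists
  have hlt : (#(box d L) : ℝ) * state J β (z / (β * Real.sqrt (blockVariance J β L))) (spinAt 0) <
      (1 - ε) * z * Real.sqrt (blockVariance J β L) := lt_of_not_ge hLnot
  exact gaussianGap_false hz hε hδ hL2 hL1
    (state_blockTilt_le_of_responseDeficit J β hβ hJ hJt hz hε hε1.le L hlt)

end BlockSpin

end LongRangeIsing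

open LongRangeIsing

/-! ### 5. On `ℤ³`: the isotherm of the Gaussian members of `Z3Model`, and the interaction-uniform status of
"isotherm deficit" -/

/-- **Barrier `IsothermDominanceOnZ3` (audit 2026-08-16, generation 14, of `LongRangeTrivialityOnZ3Proofs.lean`:
the FIELD DIRECTION).** On `ℤ³`, for every reflection-positive model `J_{x,y} = C₀|x-y|₁^{-3-α}`, `C₀ > 0`,
`0 < α < 3/2`, the CRITICAL ISOTHERM DOMINATES BLOCK LINEAR RESPONSE AT THE FLUCTUATION SCALE: for every `z > 0`
and `ε > 0`, eventually in `L`,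
`(1 - ε) · z√Σ_L(β_c) ≤ |Λ_L| · m(β_c, h_L(z))`, `h_L(z) := z/(β_c√Σ_L(β_c))`, `m(β,h) := ⟨σ₀⟩_{J,h,β}` —
the infinite-volume magnetisation in the homogeneous field of `z` block-fluctuation units is at least the full
linear response `β_c h_L(z) Σ_L = z√Σ_L` of the block `M_L = ∑_{x∈Λ_L}σ_x`. PROVED (`IsothermDominanceOnZ3_holds`).
It is the in-field companion of `LongRangeTrivialityOnZ3` / `LongRangeTrivialityOnZ3BlockSpin`: the route to
clause (iii) through the critical isotherm (Camia–Garban–Newman's planar route; on `ℤ³` the residual of route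
`PerfectScreening`, crux `CoulombImpliesNontrivial`, and the card `flat-isotherm-subquadratic-mgf`) consumes
exactly the NEGATION of this dominance, which no previous generation of the audit records.

BARRIER (structured block, D-0021):
- technique_class: interaction-uniform methods on `ℤ³`, `InteractionUniformZ3 Φ := ∀ m : Z3Model, Φ m`, as for the parent `LongRangeTrivialityOnZ3`, now for conclusions about the CRITICAL ISOTHERM `h ↦ m(β_c,h) = ⟨σ₀⟩_{J,h,β_c}` (the in-field one-point function) at the block-fluctuation field scale `h_L(z) = z/(β_c√Σ_L)`: ISOTHERM-DEFICIT arguments — "`|Λ_L|·m(β_c,h_L(z)) ≤ (1-c)·z√Σ_L/2` for some `z, c > 0` and infinitely many `L`" (formally the hypothesis `hdef` of `LongRangeIsing.not_tendsto_mgfDeviation_of_isothermDeficit`), and its exponent forms: the upper critical isotherm `m(β_c,h) ≤ A h^{1/δ}` with the HYPERSCALING value `1/δ = (d-2+η)/(d+2-η)` together with `Σ_L ≥ cL^{d+2-η}` for the same `η` ("the critical isotherm is too flat for a Gaussian": then `log⟨e^{zT_L}⟩ ≤ |Λ_L|β_c∫₀^{h_L(z)}m ≤ C z^{1+1/δ}`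 uniformly in `L`, `< z²/2` for large `z`), the one-arm hyperscaling bound `⟨σ₀⟩⁺_{Λ_R;β_c} ≤ C⟨σ₀σ_{Re₁}⟩^{1/2}_{β_c}` that implies it by the GHS tangent line `⟨σ₀⟩⁺_{Λ;β_c,h} ≤ ⟨σ₀⟩⁺_{Λ;β_c,0} + β_c h∑_{y∈Λ}⟨σ₀;σ_y⟩⁺_{Λ;β_c,0}` (tree: `stub_isothermOfOneArm`, `coulombImpliesNontrivial_of_upperCriticalIsotherm` of `Summits/CriticalPhenomena/Ising3DConformalLimit/Theorems/PerfectScreeningCoulombImpliesNontrivial*`, at `η = 0`: `m(β_c,h) ≤ Ah^{1/5}`), and the planar template "`F(h) := ⟨M_L⟩_{β_c,h,+} = ∂_h log⟨e^{hM_L}⟩_{β_c,0,+} ≤ F(0) + hF′(0)`", `⟨M_L⟩_{β_c,0,+} ≤ CL²ρ(L)^{1/2}` [cite: CamiaGarbanNewman2012, §2 (proof of the upper bound: the display defining F(h), eq. (2.2) and Proposition 7), p. 4] whose output is "`log P(m > x) ∼ -cx^{16}` … In particular, this provides an alternative proof that the field `Φ^∞` is non-Gaussian" and "`|E e^{itm}|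 ≤ e^{-c̃|t|^{16/15}}`" [cite: CamiaGarbanNewman2016, Theorem 1.2 (i)–(ii), p. 2]
- blocks: "the critical isotherm shows a deficit against block linear response at the fluctuation scale" (and a fortiori "`log⟨e^{zT_L}⟩_{β_c} = O(z^{1+1/δ})` uniformly in `L` with `δ < ∞`", "`m(β_c,·)` and `Σ_L(β_c)` obey magnetic hyperscaling with amplitudes") as an interaction-uniform conclusion on `ℤ³`: for every member `C₀|x-y|₁^{-3-α}`, `α < 3/2`, the opposite holds — `(1-ε)z√Σ_L ≤ |Λ_L|m(β_c,h_L(z))` eventually, for all `z, ε > 0` (`IsothermDominanceOnZ3_holds`; `not_isothermDeficit_algebraic`, `not_interactionUniformZ3_isothermDeficit`); the SUFFICIENCY of the deficit for block non-Gaussianity is itself interaction-uniform and proved for every translation-invariant ferromagnet `J ≥ 0` on `ℤ^d`, `β > 0` (`LongRangeIsing.not_tendsto_mgfDeviation_of_isothermDeficit`: `⟨e^{zT_L}⟩_{J,0,β} ≤ e^{(1-c)z²/2}` at the deficit scales), so a nearest-neighbour proof along this route must establish the deficit by an input failing for every `α < 3/2` — which the deficit itself does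
- because: ONE Griffiths inequality and Jensen: tilting the zero-field free state by `e^{βhM_L}` is the pair system with the site couplings `βh𝟙_{Λ_L} ≤ βh`, so `⟨σ_x⟩_{tilt} ≤ ⟨σ_x⟩_{Λ,J,h,β} ≤ ⟨σ₀⟩_{J,h,β}` (Griffiths' comparison of couplings [cite: FriedliVelenik2017, Exercise 3.31, p. 142], monotone volume limit, translation invariance: `LongRangeIsing.expectIn_blockSpin_mul_blockTilt_le`), and `⟨e^{βh₁M_L}⟩/⟨e^{βh₂M_L}⟩ = ⟨e^{-β(h₂-h₁)M_L}⟩_{tilt h₂} ≥ e^{-β(h₂-h₁)⟨M_L⟩_{tilt h₂}}`, whence `⟨e^{βh₂M_L}⟩_{J,0,β} ≤ exp(β(h₂-h₁)|Λ_L|m(β,h₂))·⟨e^{βh₁M_L}⟩_{J,0,β}` for `0 ≤ h₁ ≤ h₂` and EVERY ferromagnet (`LongRangeIsing.state_blockTilt_le_exp_mul` — the `d`-dimensional free-state form of Camia–Garban–Newman's first step [cite: CamiaGarbanNewman2012, §2 (the display defining F(h) and eq. (2.2)), p. 4]); the `α < 3/2` members have Gaussian block moment generating functions `⟨e^{zT_L}⟩_{β_c}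 → e^{z²/2}` (generation 10, `LongRangeTrivialityOnZ3BlockSpin_holds`) [cite: Panis2023Triviality, Theorem 1.2], and the two Gaussian limits at `z₁ = (1-ε)z < z₂ = z` are incompatible with a response deficit (`LongRangeIsing.isotherm_dominates_of_blockGaussian`, `gaussianGap_false`: `(1-ε)² + 2ε(1-ε) = 1 - ε² < 1`); in exponents (on paper): the members have the MEAN-FIELD isotherm "`c h^{1/3} ≤ M(β_c,h) ≤ C′h^{1/3}|ln h|^μ`", `μ = 0` for `d_eff > 4` [cite: AizenmanFernandez1988, Proposition 2.1 (b), eq. (2.10), p. 43] ("the exponents `β̂, δ, γ` and `Δ₄` exist and take their mean-field values … `δ = 3` … as soon as `d_bnd := d/min{1, σ/2} ≥ 4`" [cite: AizenmanFernandez1988, Abstract and eqs. (1.2)–(1.3), pp. 39–40]) and `Σ_L ≍ L^{3+α}` (`η = 2 - α`), so `|Λ_L|m(β_c,h_L(z))/(z√Σ_L) ≍ z^{-2/3}L^{(3-2α)/3} → ∞`: `δ = 3` exceeds the hyperscaling value `δ_hyp = (3+α)/(3-α)` and the isotherm OVER-responds at the fluctuation scale, with the exponent `3 - 2α` of the Gaussian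 rate of Theorem 1.2
- evasions_known: the deficit is available in `d = 2` for the nearest-neighbour model (above; there `δ = 15 = δ_hyp(η = 1/4)`) [cite: CamiaGarbanNewman2016, Theorem 1.2 (i)–(ii), p. 2]; on `ℤ³` for `J_nn` it is OPEN and is being attacked: it is the residual S6 "upper critical isotherm, `m(β_c,h) ≤ Ah^{1/5}` under the Coulomb antecedent `η = 0`" of crux `CoulombImpliesNontrivial` (route `PerfectScreening`, item stmt-CriticalPhenomena-13885, line `SketchPub`: `stub_cruxOfUpperCriticalIsotherm`, with `stub_isothermOfOneArm` reducing it to the one-arm bound `⟨σ₀⟩⁺_{box L;β_c,0} ≤ CL^{-1/2}` and `stub_lowerCriticalIsotherm` proving the Fisher-sharp converse `ch^{1/5} ≤ m(β_c,h)`), and crux K1 (one-arm hyperscaling) of the card `flat-isotherm-subquadratic-mgf`; the rigorous one-sided information all points the OTHER way — `δ ≥ (d+2-η)/(d-2+η)` (Buckingham–Gunton, proved by Fisher [cite: Fisher1969]), `δ ≥ 3` ("`M(β_c,h) ≥ ch^{1/3}`") for the whole Griffiths–Simon class [cite: AizenmanBarskyFernandezJSP1987], and Gaussian domination `⟨e^{zT_L}⟩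 ≤ e^{z²⟨T_L²⟩/2}` [cite: Newman1975, Theorem 5, eq. (2.8)] (tree: `newman_mgf_bounds`, `state_exp_smeared_le_of_ghs`); above the upper critical dimension the deficit FAILS for the nearest-neighbour model too — the plus-boundary one-point function of high-dimensional Ising decays like `R^{-1}` at `β_c`, not like `G(R)^{1/2} ≍ R^{-(d-2)/2}` [cite: HandaHeydenreichSakai2016] [cite: EngelenburgEtAl2025], as it must by `IsingTrivialityFromDimensionFour`; NOTHING in print or in the tree derives the deficit on `ℤ³` from the nearest-neighbour-specific two-point inputs isolated by generations 2–12 (bubble divergence, `limsup χ_L/L^{3/2} > 0`, the strict window `η < 1/2`, locality, light tail, anisotropy-sensitivity): the deficit is a ONE-point, in-field statement of hyperscaling strength, a new entry in the list of qualifying inputs and the first one recorded on the barrier side that is also SUFFICIENT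
- scope_caveats: (a) the sharply cut block `M_L` (`f = 𝟙_{[-1,1]³}`, Panis's normalising example) and the free-boundary box-limit state at zero field, tilted; the conclusion fed by a deficit is block non-Gaussianity in the sense of `LongRangeTrivialityOnZ3BlockSpin` (`⟨e^{zT_L}⟩_{β_c} ↛ e^{z²/2}`), whose interaction-uniform status is generation 10's `not_interactionUniformZ3_blockSpin_mgf`; the passage to continuous test functions (`HasNonGaussianSmearingZ3`) or to the pointwise clause (iii) (`HasNontrivialU4`, as in `coulombImpliesNontrivial_of_upperCriticalIsotherm`) is not repeated here; (b) the magnetisation is the tree's `state J β h (spinAt 0) = lim_L⟨σ₀⟩_{Λ_L,J,h,β}` (free boundary, homogeneous field `h > 0`; the unique infinite-volume state at `h ≠ 0` — uniqueness is cited, not used); its `h → 0⁺` limit is `LongRangeIsing.magnetization`, so `β_c` is the parent's; (c) only the single-step cap `log⟨e^{zT_L}⟩ ≤ z·|Λ_L|m(β,h_L(z))/√Σ_L` and the two-field comparison are formalised — the integral form `log⟨e^{zT_L}⟩ ≤ |Λ_L|β∫₀^{h_L(z)}m(β,h)dh` (Riemann sums of `state_blockTilt_le_exp_mul`) and the exponent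 bookkeeping (`δ`, `δ_hyp`, one-arm) are on paper, as is the over-response rate `L^{(3-2α)/3}` of the members; (d) dominance is proved in the `(1-ε)`-form for every `ε > 0`; nothing is claimed about `ε = 0` or about a rate; (e) `β_c > 0` is used (`panis_criticalBeta_pos_holds`); for a general `J` (e.g. `J_nn`) the sufficiency theorem is stated at any `β > 0` (`blockNonGaussian_of_isothermDeficit`); (f) the marginal member `α = 3/2` (Gaussian [cite: Panis2023Triviality, Corollary 1.11], `δ = 3 = δ_hyp` with a logarithm in the isotherm [cite: AizenmanFernandez1988, Proposition 2.1 (b), eq. (2.10), p. 43]) is outside the formal statement, as in the parent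
; (g) between the sufficient deficit `Φ_L(z) := |Λ_L|m(β_c,h_L(z))/√Σ_L ≤ (1-c)z/2` and the proved dominance `Φ_L(z) ≥ (1-ε)z` of the members lies a factor `2` — the single-step cap evaluates the nondecreasing isotherm at the endpoint; the integral form `log⟨e^{zT_L}⟩ ≤ |Λ_L|β∫₀^{h_L(z)}m(β,h)dh` (Riemann sums of `state_blockTilt_le_exp_mul`, on paper) sharpens the sufficient condition to a deficit of the AREA under the isotherm, `|Λ_L|β_c∫₀^{h_L(z)}m ≤ (1-c)z²/2` i.o.; nothing in between is claimed formally
- status: established (PROVED: `IsothermDominanceOnZ3_holds`; axioms `propext`, `Classical.choice`, `Quot.sound`)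

[cite: CamiaGarbanNewman2012, §2 (the display defining F(h) and eq. (2.2)), p. 4]
[cite: Panis2023Triviality, Theorem 1.2] -/
def IsothermDominanceOnZ3 : Prop :=
  ∀ (C₀ α : ℝ), 0 < C₀ → 0 < α → α < 3 / 2 → ∀ (z ε : ℝ), 0 < z → 0 < ε →
    ∀ᶠ L : ℕ in atTop,
      (1 - ε) * z * Real.sqrt (LongRangeIsing.blockVariance (algebraicCoupling 3 C₀ α)
          (LongRangeIsing.criticalBeta (algebraicCoupling 3 C₀ α)) L) ≤
        (#(box 3 L) : ℝ) * state (algebraicCoupling 3 C₀ α)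
          (LongRangeIsing.criticalBeta (algebraicCoupling 3 C₀ α))
          (z / (LongRangeIsing.criticalBeta (algebraicCoupling 3 C₀ α) *
            Real.sqrt (LongRangeIsing.blockVariance (algebraicCoupling 3 C₀ α)
              (LongRangeIsing.criticalBeta (algebraicCoupling 3 C₀ α)) L)))
          (spinAt 0)

/-- **The isotherm-dominance barrier holds** (Griffiths' cap + Jensen + the Gaussian block spin of the
`α < 3/2` members). [cite: Panis2023Triviality, Theorem 1.2] -/
theorem IsothermDominanceOnZ3_holds : IsothermDominanceOnZ3 := by
  intro C₀ α hC₀ hα hα' z ε hz hε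
  exact isotherm_dominates_of_blockGaussian (algebraicCoupling 3 C₀ α)
    (LongRangeIsing.criticalBeta (algebraicCoupling 3 C₀ α))
    (panis_criticalBeta_pos_holds 3 (by norm_num) C₀ α hC₀ hα) (algebraicCoupling_nonneg hC₀.le α)
    (algebraicCoupling_add C₀ α) (LongRangeTrivialityOnZ3BlockSpin_holds C₀ α hC₀ hα hα') hz hε

/-- **Sufficiency on `ℤ³`, any coupling: an isotherm deficit at the fluctuation scale forces a non-Gaussian
critical block spin** — for every translation-invariant ferromagnetic pair interaction `J ≥ 0` on `ℤ³` (the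
nearest-neighbour one included) and every `β > 0` (e.g. `β = β_c(J)` when positive): if
`|Λ_L| m(β,h_L(z)) ≤ (1-c) z√Σ_L/2` for some `z, c > 0` and infinitely many `L`, then
`⟨e^{zM_L/√Σ_L}⟩_{J,0,β} ↛ e^{z²/2}` — the conclusion shown NOT interaction-uniform at `β_c` by generation 10
(`not_interactionUniformZ3_blockSpin_mgf`). [cite: CamiaGarbanNewman2016, Theorem 1.2 (i)–(ii) and §2, pp. 2 and 4] -/
theorem blockNonGaussian_of_isothermDeficit (J : Site 3 → Site 3 → ℝ) (hJ : ∀ x y, 0 ≤ J x y)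
    (hJt : ∀ a x y, J (x + a) (y + a) = J x y) {β : ℝ} (hβ : 0 < β)
    (hdef : ∃ z c : ℝ, 0 < z ∧ 0 < c ∧ ∃ᶠ L : ℕ in atTop,
      (#(box 3 L) : ℝ) * state J β (z / (β * Real.sqrt (LongRangeIsing.blockVariance J β L))) (spinAt 0) ≤
        (1 - c) * z * Real.sqrt (LongRangeIsing.blockVariance J β L) / 2) :
    ∃ z : ℝ, ¬ Tendsto (fun L : ℕ => mgfDeviation J β L
        (Set.indicator {u : EuclideanSpace ℝ (Fin 3) | ∀ i, |u i| ≤ 1} fun _ => (1 : ℝ)) z) atTop (𝓝 0) := by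
  obtain ⟨z, c, hz, hc, hfr⟩ := hdef
  exact ⟨z, not_tendsto_mgfDeviation_of_isothermDeficit J β hβ hJ hJt hz hc hfr⟩

/-- **No isotherm deficit for the Gaussian members**: for `J = C₀|x-y|₁^{-3-α}`, `0 < α < 3/2`, there are no
`z, c > 0` with `|Λ_L| m(β_c,h_L(z)) ≤ (1-c) z√Σ_L/2` infinitely often. [cite: Panis2023Triviality, Theorem 1.2] -/
theorem not_isothermDeficit_algebraic {C₀ α : ℝ} (hC₀ : 0 < C₀) (hα : 0 < α) (hα' : α < 3 / 2) :
    ¬ ∃ z c : ℝ, 0 < z ∧ 0 < c ∧ ∃ᶠ L : ℕ in atTop,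
      (#(box 3 L) : ℝ) * state (algebraicCoupling 3 C₀ α)
          (LongRangeIsing.criticalBeta (algebraicCoupling 3 C₀ α))
          (z / (LongRangeIsing.criticalBeta (algebraicCoupling 3 C₀ α) *
            Real.sqrt (LongRangeIsing.blockVariance (algebraicCoupling 3 C₀ α)
              (LongRangeIsing.criticalBeta (algebraicCoupling 3 C₀ α)) L))) (spinAt 0) ≤
        (1 - c) * z * Real.sqrt (LongRangeIsing.blockVariance (algebraicCoupling 3 C₀ α)
          (LongRangeIsing.criticalBeta (algebraicCoupling 3 C₀ α)) L) / 2 := by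
  intro h
  obtain ⟨z, hz⟩ := blockNonGaussian_of_isothermDeficit (algebraicCoupling 3 C₀ α)
    (algebraicCoupling_nonneg hC₀.le α) (algebraicCoupling_add C₀ α)
    (panis_criticalBeta_pos_holds 3 (by norm_num) C₀ α hC₀ hα) h
  exact hz (LongRangeTrivialityOnZ3BlockSpin_holds C₀ α hC₀ hα hα' z)

/-- **"The critical isotherm shows a deficit against block linear response at the fluctuation scale" is not
interaction-uniform on `ℤ³`** (it fails for the member `α = 1`, `C₀ = 1`): a nearest-neighbour proof of
clause (iii) through the isotherm (upper critical isotherm / one-arm hyperscaling) consumes an input that fails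
for `C₀|x-y|₁^{-3-α}`, `α < 3/2` — as it must by `LongRangeTrivialityOnZ3` — and, conversely, this input is
SUFFICIENT (`blockNonGaussian_of_isothermDeficit`). [cite: Panis2023Triviality, Theorem 1.2] -/
theorem not_interactionUniformZ3_isothermDeficit :
    ¬ InteractionUniformZ3 fun m => ∃ z c : ℝ, 0 < z ∧ 0 < c ∧ ∃ᶠ L : ℕ in atTop,
      (#(box 3 L) : ℝ) * state m.coupling (LongRangeIsing.criticalBeta m.coupling)
          (z / (LongRangeIsing.criticalBeta m.coupling *
            Real.sqrt (LongRangeIsing.blockVariance m.coupling (LongRangeIsing.criticalBeta m.coupling) L))) (spinAt 0) ≤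
        (1 - c) * z * Real.sqrt (LongRangeIsing.blockVariance m.coupling (LongRangeIsing.criticalBeta m.coupling) L) / 2 :=
  not_interactionUniformZ3_of_counterexample (.algebraic 1 1 one_pos one_pos)
    (not_isothermDeficit_algebraic one_pos one_pos (by norm_num))


end Literature.Barriers.CriticalPhenomena

end
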